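import Literature.NumberTheory.PAdicHodge.AinfRamifiedOmegaPeriodNonvanishing
import Literature.NumberTheory.PAdicHodge.AinfRamifiedPSeriesContracting
import Literature.NumberTheory.PAdicHodge.AinfRamifiedTateModule
import Literature.NumberTheory.EllipticCurves.TateModuleFree
import HarnessLib

/-!
# (N1″) over the ramified base at ORDINARY (height-one) reduction: `∫_t ω ≠ 0` for every Tate-module point `t` of `Ŵ(𝒪_{ℂ_F})`
# with `t₁ ≠ 0`, for a Weierstrass equation over `𝒪_D = ℤ_p[ϖ]` whose `[Xᵖ][p]` is a unit

Topic `Literature/NumberTheory/PAdicHodge`; namespace `Literature.NumberTheory.PAdicHodge.AinfRamTop`. THEOREMS ONLY (no definition,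
no named fact, no instance, no `sorry`). The ORDINARY companion of `AinfRamifiedOmegaPeriodNonvanishing` (supersingular shape
`[p] = p·X·R + X^{p²}·S`) and `AinfRamifiedOmegaPeriodNonvanishingVarpi` (ϖ-shape): there the step `[t] = 0 ⟹ t₁ = 0` went through
(L2′) «`[p]T = 0 ⟹ T = 0` on `Ŵ(𝔫_𝒪)`», which is FALSE at height one over a ramified base (`Ĝ_m[p](ℤ_{p²}[ϖ]) ≠ 0` when
`e = p − 1`). Here it is replaced by a `ϖ`-ADIC DESCENT ALONG THE WHOLE DIVISION TOWER of Fontaine elements `T_k = [t⁽ᵏ⁾]`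
(`[p]T_{k+1} = T_k`, `θ_𝒪(T_k) = t_k`):

* §1 units of `A_inf(𝒪)` seen through `θ_𝒪` (`isUnit_of_isUnit_theta`: `ker θ_𝒪 ⊆ 𝔦 ⊆ Jac`) and `u + n` is a unit for `n ∈ 𝔫_𝒪`;
* §2 the shape of `[p]` on `𝔫_𝒪` from Silverman's `[p] = p·f + g(Xᵖ)` (tree `formalMul_prime_eq_add_expand`, `coe_evalPt₁_decomp`):
  **`[p](a) = p·a·F₁ + aᵖ·G`** with `G = [Xᵖ][p] + aᵖ·G′` — a UNIT as soon as `[Xᵖ][p]` is a unit of `𝒪_{ℂ_F}` (height one); hence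
  (A) `ϖ ∣ [p]a ⟹ ϖ ∣ a` (`A_inf(𝒪)/ϖ = 𝒪_{ℂ_F}♭` is reduced, tree `AinfRam.varpi_dvd_of_varpi_dvd_pow`) and, with NO height hypothesis,
  (B) `ϖᵏ ∣ a`, `k ≥ 1 ⟹ ϖᵏ⁺¹ ∣ [p]a` (`ϖ ∣ p`, `kp ≥ k + 1`);
* §3 **the tower lemma** `eq_zero_of_mulP_tower`: if `[p]T_{k+1} = T_k` on `𝔫_𝒪` for all `k` and `ϖ ∣ T₀`, then every `T_k = 0`
  ((A) by induction gives `ϖ ∣ T_k` for all `k`; (B) upgrades `ϖᵃ ∣ T_{k+1}` to `ϖᵃ⁺¹ ∣ T_k`; `⋂ₐ ϖᵃA_inf(𝒪) = 0`);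
* §4 **(N1″) `omegaPeriod_ne_zero_of_isUnit_coeff`**: `∫_t ω = 0 ⟹ [t] = 0` (L1′, tree) `⟹ [t⁽ᵏ⁾] = 0 ∀ k` (§3 with `[p][t⁽ᵏ⁺¹⁾] = [t⁽ᵏ⁾]`,
  tree `mulP_torsionLift_shift`) `⟹ t₁ = θ_𝒪([t⁽¹⁾]) = 0`; so **`∫_t ω ≠ 0` whenever `t₀ = 0`, `t₁ ≠ 0`**, for EVERY `e` and every `p`;
* §5 the Tate-module currency: `proj₁ v₀ ≠ 0` for a generator `v₀` of a `ℤ_p`-monogenic Tate module (`TateModule.div`), and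
  `omegaPeriod_seqO_ne_zero_of_isUnit_coeff` / `…_of_generator` for `τ ∈ T_pŴ♭(𝒪_{ℂ_F})`, `W♭ = W ⊗_ψ 𝒪_F`.

This is the non-vanishing `H₀ ≠ 0` input of the unit-root frame (`UnitRootFrameReciprocityFormalPoint`, hypothesis `hne`) for the ordinary K★
cells, via the identity `Pω″(τ) = p^{N+c}·∫_τ ω` (tree `TransportedHodgePairHneOmega`). BSD is not proved by any of this; K★
(`stmt-BirchSwinnertonDyer-22226`) stays open.

## References
* [Fontaine1982FormesDifferentielles] J.-M. Fontaine, Invent. Math. 65 (1982), §5 (the period pairing `T_pĜ × ω_G → B_dR⁺`, injective on `T_pĜ⁰`).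
* [Tate1967] J. Tate, *p-divisible groups* (1967), §4 (Hodge–Tate decomposition; the connected part).
* [SilvermanAEC2009] J. H. Silverman, *AEC* (2009), IV.4.4 (`[p] = pf + g(Xᵖ)`), IV.7 (height), III.§7.
* [FarguesFontaine2018] L. Fargues, J.-M. Fontaine, Astérisque 406 (2018), §1.2, §2.2 (`A_inf/p = 𝒪♭` perfect).
* [FontaineAsterisque223III] J.-M. Fontaine, Astérisque 223 (1994), Exp. II §1.2–§1.3.
-/

noncomputable section

open Ideal Field ValuativeRel

namespace Literature.NumberTheory.PAdicHodge

open Literature.NumberTheory.GaloisRepresentations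
open Literature.NumberTheory.GaloisRepresentations.IsNonarchimedeanLocalField
open Literature.NumberTheory.GaloisRepresentations.LubinTate
open Literature.NumberTheory.EllipticCurves

namespace AinfRamTop

variable {F : Type} [Field F] [ValuativeRel F] [TopologicalSpace F] [IsNonarchimedeanLocalField F] [CharZero F]
  {p : ℕ} [Fact p.Prime] [Fact (¬ IsUnit (p : integerC F))] [IsAdicComplete (Ideal.span {(p : integerC F)}) (integerC F)]
  {hp : valuation F p < 1} {D : EisensteinRoot F p hp}
  {hθ : Function.Surjective (WittVector.fontaineTheta (integerC F) p)}

/-! ## §1 Units of `A_inf(𝒪)` through `θ_𝒪` -/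

/-- **An element of `A_inf(𝒪)` whose `θ_𝒪`-image is a unit of `𝒪_{ℂ_F}` is a unit**: with `θ_𝒪(y) = θ_𝒪(x)⁻¹`, `xy − 1 ∈ ker θ_𝒪 ⊆ 𝔦 ⊆ Jac`.
[cite: FontaineAsterisque223III, Exp. II §1.3.2] -/
theorem isUnit_of_isUnit_theta (hθ : Function.Surjective (WittVector.fontaineTheta (integerC F) p)) {x : AinfRamTop D}
    (hx : IsUnit (theta D x)) : IsUnit x := by
  obtain ⟨u, hu⟩ := hx
  obtain ⟨y, hy⟩ := theta_surjective (D := D) hθ (↑u⁻¹ : CBall F)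
  have h1 : theta D (x * y) = theta D 1 := by rw [map_mul, map_one, ← hu, hy, Units.mul_inv]
  have h2 : x * y - 1 ∈ (WithIdeal.i : Ideal (AinfRamTop D)) := sub_mem_ideal_of_theta_eq h1
  have h3 : IsUnit (x * y) := by
    have h4 := Ideal.mem_jacobson_bot.1 (ideal_le_jacobson (D := D) h2) 1
    rwa [mul_one, sub_add_cancel] at h4
  exact isUnit_of_mul_isUnit_left h3

/-- **`x + n` is a unit for a unit `x` and `n ∈ 𝔫_𝒪`** (`𝔫_𝒪 ⊆ Jac(A_inf(𝒪))`). [cite: FontaineAsterisque223III, Exp. II §1.3.2] -/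
theorem isUnit_add_of_mem_nilTheta {x n : AinfRamTop D} (hx : IsUnit x) (hn : n ∈ (nilTheta D hθ).toIdeal) : IsUnit (x + n) := by
  obtain ⟨u, rfl⟩ := hx
  have h := Ideal.mem_jacobson_bot.1 (mem_jacobson_of_mem_nilTheta hn) (↑u⁻¹ : AinfRamTop D)
  have h1 : (u : AinfRamTop D) * (u⁻¹ : (AinfRamTop D)ˣ) = 1 := Units.mul_inv u
  have h2 : (u : AinfRamTop D) + n = u * (n * (u⁻¹ : (AinfRamTop D)ˣ) + 1) := by linear_combination (-n) * h1
  rw [h2]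
  exact (Units.isUnit u).mul h

/-- **The scalar `[Xᵖ][p] ∈ 𝒪_D`, read in `A_inf(𝒪)`, is a unit when its image in `𝒪_{ℂ_F}` is a unit** (height one), since
`θ_𝒪(c·1) = c·1`. [cite: SilvermanAEC2009, IV.7] -/
theorem isUnit_algebraMap_of_isUnit (hθ : Function.Surjective (WittVector.fontaineTheta (integerC F) p)) {c : EisensteinRoot.CoeffDisc D}
    (hc : IsUnit (algebraMap (EisensteinRoot.CoeffDisc D) (CBall F) c)) :
    IsUnit (algebraMap (EisensteinRoot.CoeffDisc D) (AinfRamTop D) c) :=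
  isUnit_of_isUnit_theta hθ (by rw [EisensteinRoot.theta_algebraMap_coeffDisc]; exact hc)

/-! ## §2 The uniformizer `ϖ` in `AinfRamTop D` and the shape of `[p]` on `𝔫_𝒪` -/

omit [IsAdicComplete (Ideal.span {(p : integerC F)}) (integerC F)] in
/-- `ϖ ∣ p` in `A_inf(𝒪)` (tree `AinfRam.varpi_dvd_natCast`, transported along `of`). [cite: SerreLocalFields1979, Ch. I §6 Prop. 17] -/
theorem of_varpi_dvd_natCast : of D (AinfRam.varpi D) ∣ (p : AinfRamTop D) := by
  have h := map_dvd (of D) (AinfRam.varpi_dvd_natCast D)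
  rwa [map_natCast] at h

omit [IsAdicComplete (Ideal.span {(p : integerC F)}) (integerC F)] in
/-- `ϖ ∣ xⁿ ⟹ ϖ ∣ x` in `A_inf(𝒪)` (`A_inf(𝒪)/ϖ = 𝒪_{ℂ_F}♭` is a domain; tree `AinfRam.varpi_dvd_of_varpi_dvd_pow`).
[cite: FarguesFontaine2018, §1.2] -/
theorem of_varpi_dvd_of_dvd_pow {x : AinfRamTop D} {n : ℕ} (h : of D (AinfRam.varpi D) ∣ x ^ n) : of D (AinfRam.varpi D) ∣ x := by
  have h1 : AinfRam.varpi D ∣ ((of D).symm x) ^ n := by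
    have h2 := map_dvd (of D).symm h
    rwa [map_pow, RingEquiv.symm_apply_apply] at h2
  have h3 := map_dvd (of D) (AinfRam.varpi_dvd_of_varpi_dvd_pow D h1)
  rwa [RingEquiv.apply_symm_apply] at h3

/-- `⋂ₖ ϖᵏ A_inf(𝒪) = 0` (tree `AinfRam.eq_zero_of_forall_varpi_pow_dvd`). [cite: FontaineAsterisque223III, Exp. II §1.3.2] -/
theorem eq_zero_of_forall_of_varpi_pow_dvd {x : AinfRamTop D} (h : ∀ k : ℕ, of D (AinfRam.varpi D) ^ k ∣ x) : x = 0 := by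
  have h1 : (of D).symm x = 0 := AinfRam.eq_zero_of_forall_varpi_pow_dvd D fun k => by
    have h2 := map_dvd (of D).symm (h k)
    rwa [map_pow, RingEquiv.symm_apply_apply] at h2
  simpa using congrArg (of D) h1

variable (W : WeierstrassCurve (EisensteinRoot.CoeffDisc D))

/-- **The shape of `[p]` on `𝔫_𝒪`**: `[p](a) = p·(a·F₁) + aᵖ·([Xᵖ][p]·1 + aᵖ·G′)` for some `F₁, G′ ∈ A_inf(𝒪)` — Silverman's
`[p] = p·f + g(Xᵖ)` with `f(0) = g(0) = 0`, `g′(0) = [Xᵖ][p]`, evaluated at `a` (`f(a) = a·F₁`, `g(aᵖ) = aᵖ·([Xᵖ][p] + aᵖ·G′)`).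
[cite: SilvermanAEC2009, IV.4.4] -/
theorem exists_coe_mulP_eq (a : (nilTheta D hθ).toIdeal) :
    ∃ F₁ G' : AinfRamTop D, (mulP W a : AinfRamTop D) =
      (p : AinfRamTop D) * ((a : AinfRamTop D) * F₁) +
        (a : AinfRamTop D) ^ p *
          (algebraMap (EisensteinRoot.CoeffDisc D) (AinfRamTop D) (PowerSeries.coeff p (W.formalMul p)) + (a : AinfRamTop D) ^ p * G') := by
  have hdec := coe_evalPt₁_decomp (hθ := hθ) (W.constantCoeff_formalMul p) (constantCoeff_formalMulPPart W)
    (W.constantCoeff_formalMulFrobPart p) (by rw [← PowerSeries.expand_apply]; exact W.formalMul_prime_eq_add_expand p) a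
  refine ⟨evalAt (nilTheta D hθ) a (PowerSeries.mk fun n => PowerSeries.coeff (n + 1) (W.formalMulPPart p)),
    evalAt (nilTheta D hθ) (powPt a) (PowerSeries.mk fun n => PowerSeries.coeff (n + 1)
      (PowerSeries.mk fun m => PowerSeries.coeff (m + 1) (W.formalMulFrobPart p))), ?_⟩
  have hc : PowerSeries.constantCoeff (PowerSeries.mk fun m => PowerSeries.coeff (m + 1) (W.formalMulFrobPart p)) =
      PowerSeries.coeff p (W.formalMul p) := by
    rw [← PowerSeries.coeff_zero_eq_constantCoeff_apply, PowerSeries.coeff_mk, zero_add, W.coeff_one_formalMulFrobPart]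
  rw [mulP, hdec, coe_evalPt₁_eq_evalAt, coe_evalPt₁_eq_evalAt, evalAt_eq_algebraMap_add_mul a, constantCoeff_formalMulPPart, map_zero,
    zero_add, evalAt_eq_algebraMap_add_mul (powPt a), W.constantCoeff_formalMulFrobPart, map_zero, zero_add,
    evalAt_eq_algebraMap_add_mul (powPt a), hc, coe_powPt]

/-- **(A) `ϖ ∣ [p]a ⟹ ϖ ∣ a` on `𝔫_𝒪` at height one.** With `[p](a) = p·a·F₁ + aᵖ·G`, `G` a unit (`[Xᵖ][p]` maps to a unit of `𝒪_{ℂ_F}`):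
`ϖ ∣ p`, so `ϖ ∣ aᵖ·G`, so `ϖ ∣ aᵖ`, so `ϖ ∣ a`. [cite: SilvermanAEC2009, IV.4.4 and IV.7] [cite: FarguesFontaine2018, §1.2] -/
theorem of_varpi_dvd_of_dvd_mulP (hunit : IsUnit (algebraMap (EisensteinRoot.CoeffDisc D) (CBall F) (PowerSeries.coeff p (W.formalMul p))))
    (a : (nilTheta D hθ).toIdeal) (h : of D (AinfRam.varpi D) ∣ (mulP W a : AinfRamTop D)) : of D (AinfRam.varpi D) ∣ (a : AinfRamTop D) := by
  obtain ⟨F₁, G', hFG⟩ := exists_coe_mulP_eq (hθ := hθ) W a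
  have hG : IsUnit (algebraMap (EisensteinRoot.CoeffDisc D) (AinfRamTop D) (PowerSeries.coeff p (W.formalMul p)) + (a : AinfRamTop D) ^ p * G') :=
    isUnit_add_of_mem_nilTheta (isUnit_algebraMap_of_isUnit hθ hunit)
      (Ideal.mul_mem_right _ _ (Ideal.pow_mem_of_mem _ a.2 _ (Fact.out : p.Prime).pos))
  rw [hFG] at h
  have h1 : of D (AinfRam.varpi D) ∣ (p : AinfRamTop D) * ((a : AinfRamTop D) * F₁) := (of_varpi_dvd_natCast (D := D)).mul_right _
  have h2 : of D (AinfRam.varpi D) ∣ (a : AinfRamTop D) ^ p *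
      (algebraMap (EisensteinRoot.CoeffDisc D) (AinfRamTop D) (PowerSeries.coeff p (W.formalMul p)) + (a : AinfRamTop D) ^ p * G') :=
    (dvd_add_right h1).1 h
  exact of_varpi_dvd_of_dvd_pow ((hG.dvd_mul_right).1 h2)

/-- **(B) `ϖᵏ ∣ a`, `1 ≤ k ⟹ ϖᵏ⁺¹ ∣ [p]a` on `𝔫_𝒪`** (no height hypothesis): `[p](a) = p·a·F₁ + aᵖ·G` with `ϖ ∣ p` and `kp ≥ k + 1`.
[cite: SilvermanAEC2009, IV.4.4] [cite: SerreLocalFields1979, Ch. I §6 Prop. 17] -/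
theorem of_varpi_pow_succ_dvd_mulP (a : (nilTheta D hθ).toIdeal) {k : ℕ} (hk : 1 ≤ k) (h : of D (AinfRam.varpi D) ^ k ∣ (a : AinfRamTop D)) :
    of D (AinfRam.varpi D) ^ (k + 1) ∣ (mulP W a : AinfRamTop D) := by
  obtain ⟨F₁, G', hFG⟩ := exists_coe_mulP_eq (hθ := hθ) W a
  rw [hFG]
  refine dvd_add ?_ ?_
  · rw [pow_succ', ← mul_assoc]
    exact (mul_dvd_mul of_varpi_dvd_natCast h).mul_right _
  · have h1 : of D (AinfRam.varpi D) ^ (k + 1) ∣ (a : AinfRamTop D) ^ p := by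
      have h2 : of D (AinfRam.varpi D) ^ (k * p) ∣ (a : AinfRamTop D) ^ p := by rw [pow_mul]; exact pow_dvd_pow_of_dvd h p
      exact (pow_dvd_pow _ (by nlinarith [(Fact.out : p.Prime).two_le])).trans h2
    exact h1.mul_right _

/-! ## §3 The tower lemma -/

/-- **The tower lemma at height one.** If `T : ℕ → 𝔫_𝒪` satisfies `[p]T_{k+1} = T_k` for all `k`, `ϖ ∣ T₀`, and `[Xᵖ][p]_W` maps to a unit of
`𝒪_{ℂ_F}`, then **`T_k = 0` for every `k`**: (A) gives `ϖ ∣ T_k` for all `k` by induction, (B) upgrades `ϖᵃ ∣ T_{k+1}` to `ϖᵃ⁺¹ ∣ T_k`, so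
`ϖᵃ ∣ T_k` for all `a, k`, and `⋂ₐ ϖᵃA_inf(𝒪) = 0`. [cite: SilvermanAEC2009, IV.4.4 and IV.7] [cite: FarguesFontaine2018, §1.2 and §2.2] -/
theorem eq_zero_of_mulP_tower (hunit : IsUnit (algebraMap (EisensteinRoot.CoeffDisc D) (CBall F) (PowerSeries.coeff p (W.formalMul p))))
    (T : ℕ → (nilTheta D hθ).toIdeal) (hT : ∀ k, (mulP W (T (k + 1)) : AinfRamTop D) = T k)
    (h0 : of D (AinfRam.varpi D) ∣ (T 0 : AinfRamTop D)) (k : ℕ) : (T k : AinfRamTop D) = 0 := by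
  -- (A): `ϖ ∣ T k` for all `k`
  have hA : ∀ k, of D (AinfRam.varpi D) ∣ (T k : AinfRamTop D) := by
    intro k
    induction k with
    | zero => exact h0
    | succ k ih => exact of_varpi_dvd_of_dvd_mulP W hunit (T (k + 1)) (by rw [hT k]; exact ih)
  -- (B): `ϖ^(a+1) ∣ T k` for all `a`, `k`
  have hB : ∀ a k : ℕ, of D (AinfRam.varpi D) ^ (a + 1) ∣ (T k : AinfRamTop D) := by
    intro a
    induction a with
    | zero => intro k; rw [zero_add, pow_one]; exact hA k
    | succ a ih => intro k; rw [← hT k]; exact of_varpi_pow_succ_dvd_mulP W (T (k + 1)) (Nat.succ_le_succ (Nat.zero_le a)) (ih (k + 1))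
  refine eq_zero_of_forall_of_varpi_pow_dvd fun a => ?_
  rcases a with _ | a
  · rw [pow_zero]; exact one_dvd _
  · exact hB a k

/-! ## §4 (N1″): `∫_t ω ≠ 0` when `t₁ ≠ 0`, at height one -/

/-- Fontaine's element of a `[p]`-compatible sequence does not depend on how the sequence is presented (congruence in `t`).
[cite: FontaineAsterisque223III, Exp. II §1.2.2] -/
theorem torsionLift_congr {t t' : ℕ → (maxNilIdealC F).toIdeal} (h : ∀ n, t n = t' n) (htp : ∀ n, mulPC W (t (n + 1)) = t n)
    (htp' : ∀ n, mulPC W (t' (n + 1)) = t' n) : torsionLift W hθ t htp = torsionLift W hθ t' htp' := by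
  obtain rfl : t = t' := funext h
  rfl

/-- `[p]` on `Ŵ(𝔫_𝒪)` depends only on the underlying element (congruence). [cite: SilvermanAEC2009, IV.2–IV.3] -/
theorem mulP_congr_pt {a b : (nilTheta D hθ).toIdeal} (h : (a : AinfRamTop D) = b) : (mulP W a : AinfRamTop D) = mulP W b := by
  rw [Subtype.ext h]

omit [Fact (¬ IsUnit (p : integerC F))] [IsAdicComplete (Ideal.span {(p : integerC F)}) (integerC F)] in
/-- The `k`-fold shifted sequence `n ↦ t_{n+k}` is `[p]`-compatible. [cite: SilvermanAEC2009, III.§7] -/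
theorem mulPC_shift_add {t : ℕ → (maxNilIdealC F).toIdeal} (htp : ∀ n, mulPC W (t (n + 1)) = t n) (k n : ℕ) :
    mulPC W (t (n + 1 + k)) = t (n + k) := by
  rw [Nat.add_right_comm]; exact htp (n + k)

/-- **`[p]·[t⁽ᵏ⁺¹⁾] = [t⁽ᵏ⁾]`** for the shifted sequences `t⁽ᵏ⁾ₙ = tₙ₊ₖ` (tree `mulP_torsionLift_shift` at `t⁽ᵏ⁾`).
[cite: FontaineAsterisque223III, Exp. II §1.2.2] -/
theorem mulP_torsionLift_shift_add {t : ℕ → (maxNilIdealC F).toIdeal} (htp : ∀ n, mulPC W (t (n + 1)) = t n) (k : ℕ) :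
    (mulP W ⟨torsionLift W hθ (fun n => t (n + (k + 1))) (mulPC_shift_add W htp (k + 1)), flim_mem_nilTheta _ _⟩ : AinfRamTop D) =
      torsionLift W hθ (fun n => t (n + k)) (mulPC_shift_add W htp k) := by
  have h2 := mulP_torsionLift_shift W (hθ := hθ) (t := fun n => t (n + k)) (mulPC_shift_add W htp k)
  beta_reduce at h2
  exact Eq.trans (mulP_congr_pt W (torsionLift_congr W (t := fun n => t (n + (k + 1))) (t' := fun n => t (n + 1 + k))
    (fun n => congrArg t (by omega)) (mulPC_shift_add W htp (k + 1)) (fun n => mulPC_shift_add W htp k (n + 1)))) h2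

/-- **(N1″) over the ramified base at height one.** For `W` over `𝒪_D = ℤ_p[ϖ]` whose `[Xᵖ][p]_W` maps to a UNIT of `𝒪_{ℂ_F}` (ordinary /
height-one formal group; ANY ramification index `e`, any `p`), and every `[p]`-compatible sequence `t` of points of `Ŵ(𝔪_{ℂ_F})` with `t₀ = 0`
and `t₁ ≠ 0`: **`∫_t ω = log_W(ι_𝒪[t]) ≠ 0` in `B_dR⁺`.** Proof: `∫_t ω = 0 ⟹ [t] = 0` (L1′) `⟹ [t⁽ᵏ⁾] = 0` for all `k` (tower lemma with
`[p][t⁽ᵏ⁺¹⁾] = [t⁽ᵏ⁾]`) `⟹ t₁ = θ_𝒪([t⁽¹⁾]) = 0`. [cite: Fontaine1982FormesDifferentielles, §5] [cite: Tate1967, §4] [cite: SilvermanAEC2009, IV.7] -/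
theorem omegaPeriod_ne_zero_of_isUnit_coeff
    (hunit : IsUnit (algebraMap (EisensteinRoot.CoeffDisc D) (CBall F) (PowerSeries.coeff p (W.formalMul p))))
    {t : ℕ → (maxNilIdealC F).toIdeal} (ht0 : (t 0 : CBall F) = 0) (htp : ∀ n, mulPC W (t (n + 1)) = t n)
    (h1 : (t 1 : CBall F) ≠ 0) : omegaPeriod W hθ t ht0 htp ≠ 0 := by
  intro h
  have hL1 : torsionLift W hθ t htp = 0 := torsionLift_eq_zero_of_omegaPeriod_eq_zero W ht0 htp h
  -- the tower of Fontaine elements of the shifted sequences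
  have hzero := eq_zero_of_mulP_tower (hθ := hθ) W hunit
    (fun k => ⟨torsionLift W hθ (fun n => t (n + k)) (mulPC_shift_add W htp k), flim_mem_nilTheta _ _⟩)
    (fun k => mulP_torsionLift_shift_add W htp k)
    (by
      have h0 : torsionLift W hθ (fun n => t (n + 0)) (mulPC_shift_add W htp 0) = 0 :=
        (torsionLift_congr W (t := fun n => t (n + 0)) (t' := t) (fun n => congrArg t (Nat.add_zero n)) (mulPC_shift_add W htp 0) htp).trans hL1
      change of D (AinfRam.varpi D) ∣ torsionLift W hθ (fun n => t (n + 0)) (mulPC_shift_add W htp 0)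
      rw [h0]; exact dvd_zero _)
    1
  have hθ1 : theta D (torsionLift W hθ (fun n => t (n + 1)) (mulPC_shift_add W htp 1)) = t (0 + 1) :=
    theta_torsionLift_eq W (hθ := hθ) (t := fun n => t (n + 1)) (mulPC_shift_add W htp 1)
  change torsionLift W hθ (fun n => t (n + 1)) (mulPC_shift_add W htp 1) = 0 at hzero
  rw [hzero, map_zero, zero_add] at hθ1
  exact h1 hθ1.symm

/-! ## §5 The Tate-module currency -/

/-- **A generator of a `ℤ_p`-monogenic Tate module has non-zero first component**: if `T_p A = ℤ_p·v₀`, `v₀ ≠ 0` and `proj₁ v₀ = 0`, then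
`v₀ = p•v′` (`TateModule.div`), `v′ = c•v₀`, so `(1 − pc)•v₀ = 0` with `1 − pc ∈ ℤ_pˣ`. [cite: SilvermanAEC2009, III.§7] [cite: Tate1967, §2.2] -/
theorem _root_.Literature.NumberTheory.EllipticCurves.TateModule.proj_one_ne_zero_of_generator {A : Type*} [AddCommGroup A]
    {v₀ : TateModule A p} (hv₀ : v₀ ≠ 0) (hgen : ∀ τ : TateModule A p, ∃ c : ℤ_[p], τ = c • v₀) : TateModule.proj p 1 v₀ ≠ 0 := by
  intro h
  obtain ⟨c, hc⟩ := hgen (TateModule.div v₀ h)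
  have h1 : ((p : ℤ_[p]) * c) • v₀ = v₀ := by rw [mul_smul, ← hc, TateModule.p_smul_div]
  have h2 : (1 - (p : ℤ_[p]) * c) • v₀ = 0 := by rw [sub_smul, one_smul, h1, sub_self]
  have hpc : ¬ IsUnit ((p : ℤ_[p]) * c) := fun hu => PadicInt.irreducible_p.not_isUnit (isUnit_of_mul_isUnit_left hu)
  have hu : IsUnit (1 - (p : ℤ_[p]) * c) := (IsLocalRing.isUnit_or_isUnit_one_sub_self ((p : ℤ_[p]) * c)).resolve_left hpc
  obtain ⟨u, hu'⟩ := hu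
  rw [← hu'] at h2
  exact hv₀ (by rw [← one_smul ℤ_[p] v₀, ← u.inv_mul, mul_smul, h2, smul_zero])

variable (ψ : EisensteinRoot.CoeffDisc D →+* LTCoeff F) (hψ : ∀ c, algebraMap (LTCoeff F) F (ψ c) = EisensteinRoot.CoeffDisc.toF D c)

include hψ in
/-- **(N1″) in the Tate-module currency**: for `W` over `𝒪_D` with `[Xᵖ][p]_W` a unit of `𝒪_{ℂ_F}` and `τ ∈ T_pŴ♭(𝒪_{ℂ_F})` (`W♭ = W ⊗_ψ 𝒪_F`) with
`τ₁ ≠ 0`: **`∫_τ ω ≠ 0`** for the coordinate sequence `seqO τ`. [cite: Fontaine1982FormesDifferentielles, §5] [cite: Tate1967, §4] -/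
theorem omegaPeriod_seqO_ne_zero_of_isUnit_coeff
    (hunit : IsUnit (algebraMap (EisensteinRoot.CoeffDisc D) (CBall F) (PowerSeries.coeff p (W.formalMul p))))
    (τ : AinfTop.TatePtO F (W.map ψ) p) (h1 : TateModule.proj p 1 τ ≠ 0) :
    omegaPeriod W hθ (AinfTop.seqO (W.map ψ) τ) (AinfTop.seqO_zero (W.map ψ) τ) (mulPC_seqO W ψ hψ τ) ≠ 0 :=
  omegaPeriod_ne_zero_of_isUnit_coeff W hunit _ _ fun h => h1 (WeierstrassCurve.Pt.ext (Subtype.ext (by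
    rw [AinfTop.seqO_apply] at h
    rw [h, WeierstrassCurve.Pt.val_zero, ZeroMemClass.coe_zero])))

include hψ in
/-- **(N1″) for a generator of `T_pŴ♭ = ℤ_p·v₀`** (height one: `FormalTateModuleRankOne.exists_generator_tatePtO_of_isUnit`): **`∫_{v₀} ω ≠ 0`.**
[cite: Fontaine1982FormesDifferentielles, §5] [cite: Tate1967, §4] -/
theorem omegaPeriod_seqO_ne_zero_of_generator
    (hunit : IsUnit (algebraMap (EisensteinRoot.CoeffDisc D) (CBall F) (PowerSeries.coeff p (W.formalMul p))))
    {v₀ : AinfTop.TatePtO F (W.map ψ) p} (hv₀ : v₀ ≠ 0) (hgen : ∀ τ : AinfTop.TatePtO F (W.map ψ) p, ∃ c : ℤ_[p], τ = c • v₀) :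
    omegaPeriod W hθ (AinfTop.seqO (W.map ψ) v₀) (AinfTop.seqO_zero (W.map ψ) v₀) (mulPC_seqO W ψ hψ v₀) ≠ 0 :=
  omegaPeriod_seqO_ne_zero_of_isUnit_coeff W ψ hψ hunit v₀ (TateModule.proj_one_ne_zero_of_generator hv₀ hgen)

end AinfRamTop

end Literature.NumberTheory.PAdicHodge

end
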